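import Literature.NumberTheory.Sieve.BatemanHornMertensProduct
import Summits.Parity.BatemanHorn.Theorems.SystemLSDRealSegment.Negative.FinZero
import HarnessLib

/-!
# Route `RoughValueTransport`, support item `SieveCalibration` (stmt-Parity-11391):
# Mertens' theorem with staggered thresholds

Helper file (`--supports stmt-Parity-11391`) for the proof of
`Summit.Parity.BatemanHorn.Theses.RoughValueTransport.SieveCalibration`
(`Theorems/RoughValueTransportSieveCalibration.lean`).  Main result
`SieveCalibration.tendsto_log_pow_mul_staggeredProd`: for a Bateman–Horn system `f = (f₁,…,f_k)`
and `U ≥ deg fᵢ` for all `i`,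

  `(log x)^k · V_f(x,U) → (C(f)/∏ deg fᵢ)·e^{−kγ}·U^k`   (`x → ∞`),

where `V_f(x,U) = ∏_{p ≤ x} (1 − #{r mod p : ∃ i, p < x^{deg fᵢ/U}, p ∣ fᵢ(r)}/p)` is the sieve product
with staggered thresholds `zᵢ = x^{deg fᵢ/U}` of the band theorem
`Summit.Parity.BatemanHorn.Cruxes.RoughValueLaw.IncrementAnchoring.stub_sieveBand`, written inline
verbatim (no definition is introduced), and `C(f) = batemanHornConst f`.

## Proof (sub-namespace `SieveCalibration`)

Induction on `k`, removing a polynomial `f_{i₀}` of minimal degree `d₀`.  With `g = (fᵢ)_{i ≠ i₀}`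
(`isBatemanHornSystem_succAbove`: again a Bateman–Horn system) and
`A_h(x) = ∏_{p < x^{d₀/U}} (1 − ω_h(p)/p)` one has the EXACT identity

  `V_f(x,U) · A_g(x) = V_g(x,U) · A_f(x)`   (`staggeredProd_mul_eq`, `x ≥ 1`):

below `x^{d₀/U}` every class is removed, so the factors of `V_f`, `V_g` are `1 − ω_f(p)/p`,
`1 − ω_g(p)/p` (`card_classes_eq_of_lt`); from `x^{d₀/U}` on, the removed classes of `f` and `g`
coincide (`classes_eq_of_le`).  Mertens along `f` and along `g`
(`BatemanHornMertens.tendsto_log_pow_mul_prod_one_sub_rootCount`: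
`(log n)^k ∏_{p ≤ n}(1 − ω_f(p)/p) → C(f)e^{−kγ}`) give
`log n · A_f/A_g → C(f)e^{−(k+1)γ}/(C(g)e^{−kγ})` (`tendsto_log_mul_prod_div_prod`), transported to
the threshold `n = ⌈x^{d₀/U}⌉₊ − 1` by `BatemanHornMertens.tendsto_log_pow_mul_comp`
(`log x · A_f(x)/A_g(x) → (C(f)e^{−γ}/C(g))·U/d₀`); multiplying by the induction hypothesis for `g`
gives the claim since `∏ deg fᵢ = d₀ · ∏ deg gⱼ`.  The empty system: `V = 1`, `C(∅) = 1`
(the tree's `SystemLSDRealSegment.Negative.batemanHornConst_fin_zero`).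

References: P. T. Bateman, R. A. Horn, Math. Comp. 16 (1962), §2 (the constant);
H. Halberstam, H.-E. Richert, *Sieve Methods* (1974), §5.3 (Mertens-type products for polynomial
sequences).
-/

noncomputable section

open Filter Finset Polynomial
open scoped Topology BigOperators
open Literature.NumberTheory.Sieve

namespace Summit.Parity.BatemanHorn.Theorems

namespace SieveCalibration

/-! ### Sub-systems `(fᵢ)_{i ≠ i₀}` -/

/-- Removing a polynomial does not increase `ω`: `ω_g(p) ≤ ω_f(p)` for `g = (fᵢ)_{i ≠ i₀}`. [folklore] -/
theorem polyRootCountMod_succAbove_le {k : ℕ} (f : Fin (k + 1) → ℤ[X]) (i₀ : Fin (k + 1))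
    (p : ℕ) : polyRootCountMod (fun j => f (i₀.succAbove j)) p ≤ polyRootCountMod f p := by
  unfold polyRootCountMod
  refine card_le_card fun n hn => ?_
  rw [mem_filter] at hn ⊢
  refine ⟨hn.1, hn.2.trans ?_⟩
  rw [Fin.prod_univ_succAbove (fun i => (f i).eval (n : ℤ)) i₀]
  exact dvd_mul_left _ _

/-- A sub-system `(fᵢ)_{i ≠ i₀}` of a Bateman–Horn system is a Bateman–Horn system. [folklore] -/
theorem isBatemanHornSystem_succAbove {k : ℕ} {f : Fin (k + 1) → ℤ[X]}
    (hf : IsBatemanHornSystem f) (i₀ : Fin (k + 1)) :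
    IsBatemanHornSystem (fun j => f (i₀.succAbove j)) where
  irreducible _ := hf.irreducible _
  leadingCoeff_pos _ := hf.leadingCoeff_pos _
  pairwise_not_associated _ _ hjj' :=
    hf.pairwise_not_associated (Fin.succAbove_right_injective.ne hjj')
  hasNoFixedPrimeDivisor p hp :=
    (polyRootCountMod_succAbove_le f i₀ p).trans_lt (hf.hasNoFixedPrimeDivisor p hp)

/-- In a Bateman–Horn system every Mertens factor `1 − ω_f(p)/p` (`p` prime) is positive. [folklore] -/
theorem one_sub_div_pos {ι : Type*} [Fintype ι] {f : ι → ℤ[X]}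
    (hf : IsBatemanHornSystem f) {p : ℕ} (hp : p.Prime) : 0 < 1 - (polyRootCountMod f p : ℝ) / p := by
  have hp0 : (0 : ℝ) < p := by exact_mod_cast hp.pos
  have hlt : (polyRootCountMod f p : ℝ) < p := by exact_mod_cast hf.hasNoFixedPrimeDivisor p hp
  rw [sub_pos, div_lt_one hp0]
  exact hlt

/-- The Mertens product `∏_{p ≤ n} (1 − ω_f(p)/p)` of a Bateman–Horn system is positive. [folklore] -/
theorem prod_one_sub_div_pos {ι : Type*} [Fintype ι] {f : ι → ℤ[X]}
    (hf : IsBatemanHornSystem f) (n : ℕ) : 0 < ∏ p ∈ Nat.primesLE n, (1 - (polyRootCountMod f p : ℝ) / p) :=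
  prod_pos fun _ hp => one_sub_div_pos hf (Nat.prime_of_mem_primesLE hp)

/-! ### Mertens for the ratio `A_f/A_g` -/

/-- `log n · ∏_{p ≤ n}(1 − ω_f(p)/p) / ∏_{p ≤ n}(1 − ω_g(p)/p) → C(f)e^{−(k+1)γ}/(C(g)e^{−kγ})` for
`g = (fᵢ)_{i ≠ i₀}` (Mertens along `f` and along `g`). [folklore] -/
theorem tendsto_log_mul_prod_div_prod {k : ℕ} {f : Fin (k + 1) → ℤ[X]}
    (hf : IsBatemanHornSystem f) (i₀ : Fin (k + 1)) :
    Tendsto (fun n : ℕ => Real.log n *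
        ((∏ p ∈ Nat.primesLE n, (1 - (polyRootCountMod f p : ℝ) / p)) /
          ∏ p ∈ Nat.primesLE n, (1 - (polyRootCountMod (fun j => f (i₀.succAbove j)) p : ℝ) / p)))
      atTop (𝓝 (batemanHornConst f * Real.exp (-(((k + 1 : ℕ) : ℝ) * Real.eulerMascheroniConstant)) /
        (batemanHornConst (fun j => f (i₀.succAbove j)) *
          Real.exp (-((k : ℝ) * Real.eulerMascheroniConstant))))) := by
  have hg := isBatemanHornSystem_succAbove hf i₀
  have h1 := BatemanHornMertens.tendsto_log_pow_mul_prod_one_sub_rootCount hf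
  have h2 := BatemanHornMertens.tendsto_log_pow_mul_prod_one_sub_rootCount hg
  have hne : batemanHornConst (fun j => f (i₀.succAbove j)) *
      Real.exp (-((k : ℝ) * Real.eulerMascheroniConstant)) ≠ 0 :=
    mul_ne_zero (IsBatemanHornSystem.hasBatemanHornConst_holds hg).2.ne' (Real.exp_pos _).ne'
  refine (h1.div h2 hne).congr' ?_
  filter_upwards [eventually_ge_atTop 2] with n hn
  have hlog : Real.log n ≠ 0 := (Real.log_pos (by exact_mod_cast hn)).ne'
  simp only [Pi.div_apply]
  rw [pow_succ, mul_assoc, mul_div_mul_left _ _ (pow_ne_zero k hlog), mul_div_assoc]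

/-! ### The exact identity `V_f · A_g = V_g · A_f` -/

/-- Abstract form of the identity: if on the part of `s` cut out by `P` (which is `t`) the factors
`F`, `G` are `aF`, `aG`, and off it `F = G`, then `(∏_s F)(∏_t aG) = (∏_s G)(∏_t aF)`. [folklore] -/
theorem prod_mul_prod_eq_of_filter {s t : Finset ℕ} (P : ℕ → Prop) [DecidablePred P]
    (F G aF aG : ℕ → ℝ) (ht : s.filter P = t)
    (hF : ∀ p ∈ s, P p → F p = aF p) (hG : ∀ p ∈ s, P p → G p = aG p)
    (hFG : ∀ p ∈ s, ¬ P p → F p = G p) :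
    (∏ p ∈ s, F p) * ∏ p ∈ t, aG p = (∏ p ∈ s, G p) * ∏ p ∈ t, aF p := by
  rw [← prod_filter_mul_prod_filter_not s P F, ← prod_filter_mul_prod_filter_not s P G, ← ht]
  have h1 : ∏ p ∈ s.filter P, F p = ∏ p ∈ s.filter P, aF p :=
    prod_congr rfl fun p hp => hF p (mem_filter.mp hp).1 (mem_filter.mp hp).2
  have h2 : ∏ p ∈ s.filter P, G p = ∏ p ∈ s.filter P, aG p :=
    prod_congr rfl fun p hp => hG p (mem_filter.mp hp).1 (mem_filter.mp hp).2
  have h3 : ∏ p ∈ s.filter (fun p => ¬ P p), F p = ∏ p ∈ s.filter (fun p => ¬ P p), G p :=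
    prod_congr rfl fun p hp => hFG p (mem_filter.mp hp).1 (mem_filter.mp hp).2
  rw [h1, h2, h3]
  ring

/-- Above the minimal threshold the removed classes of `f` and of `g = (fᵢ)_{i ≠ i₀}` coincide
(`deg f_{i₀}` minimal, `p ≥ x^{deg f_{i₀}/U}`). [folklore] -/
theorem classes_eq_of_le {k : ℕ} (f : Fin (k + 1) → ℤ[X]) (i₀ : Fin (k + 1)) {U : ℝ}
    {x p : ℕ} (hp : ¬ (p : ℝ) < (x : ℝ) ^ (((f i₀).natDegree : ℝ) / U)) :
    (range p).filter (fun r : ℕ => ∃ i, (p : ℝ) < (x : ℝ) ^ (((f i).natDegree : ℝ) / U) ∧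
        (p : ℤ) ∣ (f i).eval (r : ℤ)) =
      (range p).filter (fun r : ℕ => ∃ j, (p : ℝ) < (x : ℝ) ^ (((f (i₀.succAbove j)).natDegree : ℝ) / U) ∧
        (p : ℤ) ∣ (f (i₀.succAbove j)).eval (r : ℤ)) := by
  refine filter_congr fun r _ => ⟨?_, ?_⟩
  · rintro ⟨i, hi, hdvd⟩
    have hne : i ≠ i₀ := by
      rintro rfl
      exact hp hi
    obtain ⟨j, rfl⟩ := Fin.exists_succAbove_eq hne
    exact ⟨j, hi, hdvd⟩
  · rintro ⟨j, hj, hdvd⟩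
    exact ⟨i₀.succAbove j, hj, hdvd⟩

/-- Below all thresholds every class is removed: `#Ω p = ω_f(p)`. [folklore] -/
theorem card_classes_eq_of_lt {k : ℕ} (f : Fin k → ℤ[X]) {w : Fin k → ℝ} {p : ℕ}
    (hp : p.Prime) (hw : ∀ i, (p : ℝ) < w i) :
    #((range p).filter (fun r : ℕ => ∃ i, (p : ℝ) < w i ∧ (p : ℤ) ∣ (f i).eval (r : ℤ))) =
      polyRootCountMod f p :=
  BatemanHornMertens.card_filter_exists_and_dvd_eval_of_forall f hp (fun i => (p : ℝ) < w i) hw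

/-- **The exact identity.** For `i₀` of minimal degree `d₀ ≤ U` and `x ≥ 1`:
`V_f(x,U) · A_g(x) = V_g(x,U) · A_f(x)`, where `g = (fᵢ)_{i ≠ i₀}` and
`A_h(x) = ∏_{p < x^{d₀/U}} (1 − ω_h(p)/p)`. [folklore] -/
theorem staggeredProd_mul_eq {k : ℕ} (f : Fin (k + 1) → ℤ[X]) (i₀ : Fin (k + 1))
    (hmin : ∀ i, (f i₀).natDegree ≤ (f i).natDegree) {U : ℝ}
    (hU : ((f i₀).natDegree : ℝ) ≤ U) {x : ℕ} (hx : 1 ≤ x) :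
    (∏ p ∈ Nat.primesBelow (x + 1), (1 - (#((range p).filter (fun r : ℕ => ∃ i,
        (p : ℝ) < (x : ℝ) ^ (((f i).natDegree : ℝ) / U) ∧ (p : ℤ) ∣ (f i).eval (r : ℤ))) : ℝ) / (p : ℝ))) *
      ∏ p ∈ Nat.primesLE (⌈(x : ℝ) ^ (((f i₀).natDegree : ℝ) / U)⌉₊ - 1),
        (1 - (polyRootCountMod (fun j => f (i₀.succAbove j)) p : ℝ) / p) =
    (∏ p ∈ Nat.primesBelow (x + 1), (1 - (#((range p).filter (fun r : ℕ => ∃ j,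
        (p : ℝ) < (x : ℝ) ^ (((f (i₀.succAbove j)).natDegree : ℝ) / U) ∧
          (p : ℤ) ∣ (f (i₀.succAbove j)).eval (r : ℤ))) : ℝ) / (p : ℝ))) *
      ∏ p ∈ Nat.primesLE (⌈(x : ℝ) ^ (((f i₀).natDegree : ℝ) / U)⌉₊ - 1),
        (1 - (polyRootCountMod f p : ℝ) / p) := by
  set c : ℝ := ((f i₀).natDegree : ℝ) / U
  have hx1 : (1 : ℝ) ≤ x := by exact_mod_cast hx
  have hU0 : 0 ≤ U := le_trans (Nat.cast_nonneg _) hU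
  have hc1 : c ≤ 1 := div_le_one_of_le₀ hU hU0
  have hzx : (x : ℝ) ^ c ≤ x := by
    conv_rhs => rw [← Real.rpow_one (x : ℝ)]
    exact Real.rpow_le_rpow_of_exponent_le hx1 hc1
  -- thresholds: `x^c ≤ x^{deg fᵢ/U}` for every `i`
  have hci : ∀ i, (x : ℝ) ^ c ≤ (x : ℝ) ^ (((f i).natDegree : ℝ) / U) := fun i =>
    Real.rpow_le_rpow_of_exponent_le hx1
      (div_le_div_of_nonneg_right (by exact_mod_cast hmin i) hU0)
  refine prod_mul_prod_eq_of_filter (fun p : ℕ => (p : ℝ) < (x : ℝ) ^ c) _ _ _ _ ?_ ?_ ?_ ?_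
  · -- the part of `primesBelow (x+1)` below `x^c` is `primesLE (⌈x^c⌉₊ - 1)`
    ext p
    rw [mem_filter, Nat.mem_primesBelow, BatemanHornMertens.mem_primesLE_ceil_sub_one]
    constructor
    · rintro ⟨⟨-, hpp⟩, hlt⟩
      exact ⟨hpp, hlt⟩
    · rintro ⟨hpp, hlt⟩
      refine ⟨⟨?_, hpp⟩, hlt⟩
      have : (p : ℝ) ≤ x := (hlt.trans_le hzx).le
      exact Nat.lt_succ_of_le (by exact_mod_cast this)
  · intro p hp (hlt : (p : ℝ) < (x : ℝ) ^ c)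
    have hpp := (Nat.mem_primesBelow.mp hp).2
    rw [card_classes_eq_of_lt f hpp (fun i => hlt.trans_le (hci i))]
  · intro p hp (hlt : (p : ℝ) < (x : ℝ) ^ c)
    have hpp := (Nat.mem_primesBelow.mp hp).2
    rw [card_classes_eq_of_lt (fun j => f (i₀.succAbove j)) hpp
      (fun j => hlt.trans_le (hci (i₀.succAbove j)))]
  · intro p _ (hle : ¬ (p : ℝ) < (x : ℝ) ^ c)
    rw [classes_eq_of_le f i₀ hle]

/-! ### Mertens with staggered thresholds -/

/-- **Mertens with staggered thresholds** (the main-term constant of the staggered sieve):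
for a Bateman–Horn system `f` of `k` polynomials and `U ≥ deg fᵢ` for all `i`,
`(log x)^k · ∏_{p ≤ x} (1 − #{r mod p : ∃ i, p < x^{deg fᵢ/U}, p ∣ fᵢ(r)}/p) →
(C(f)/∏ deg fᵢ)·e^{−kγ}·U^k`.  Induction on `k` via `staggeredProd_mul_eq`. [folklore] -/
theorem tendsto_log_pow_mul_staggeredProd :
    ∀ (k : ℕ) (f : Fin k → ℤ[X]), IsBatemanHornSystem f → ∀ U : ℝ,
      (∀ i, ((f i).natDegree : ℝ) ≤ U) →
      Tendsto (fun x : ℕ => Real.log x ^ k * ∏ p ∈ Nat.primesBelow (x + 1),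
        (1 - (#((range p).filter (fun r : ℕ => ∃ i,
          (p : ℝ) < (x : ℝ) ^ (((f i).natDegree : ℝ) / U) ∧ (p : ℤ) ∣ (f i).eval (r : ℤ))) : ℝ) /
            (p : ℝ))) atTop
        (𝓝 (batemanHornConst f / (∏ i, ((f i).natDegree : ℝ)) *
          Real.exp (-((k : ℝ) * Real.eulerMascheroniConstant)) * U ^ k)) := by
  intro k
  induction k with
  | zero =>
      intro f _ U _
      have hlim : batemanHornConst f / (∏ i, ((f i).natDegree : ℝ)) *
          Real.exp (-(((0 : ℕ) : ℝ) * Real.eulerMascheroniConstant)) * U ^ 0 = 1 := by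
        rw [SystemLSDRealSegment.Negative.batemanHornConst_fin_zero]
        simp
      rw [hlim]
      refine tendsto_const_nhds.congr' (Eventually.of_forall fun x => ?_)
      simp only [pow_zero, one_mul]
      refine (prod_eq_one fun p _ => ?_).symm
      have hempty : (range p).filter (fun r : ℕ => ∃ i : Fin 0,
          (p : ℝ) < (x : ℝ) ^ (((f i).natDegree : ℝ) / U) ∧ (p : ℤ) ∣ (f i).eval (r : ℤ)) = ∅ :=
        filter_false_of_mem fun r _ => fun ⟨i, _⟩ => i.elim0
      rw [hempty, card_empty, Nat.cast_zero, zero_div, sub_zero]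
  | succ k IH =>
      intro f hf U hU
      -- a polynomial `f i₀` of minimal degree `d₀`
      obtain ⟨i₀, -, hi₀⟩ := exists_min_image univ (fun i => (f i).natDegree) ⟨0, mem_univ _⟩
      have hmin : ∀ i, (f i₀).natDegree ≤ (f i).natDegree := fun i => hi₀ i (mem_univ i)
      have hd₀0 : (0 : ℝ) < (f i₀).natDegree := by exact_mod_cast hf.natDegree_pos i₀
      have hU0 : 0 < U := lt_of_lt_of_le hd₀0 (hU i₀)
      have hc0 : 0 < ((f i₀).natDegree : ℝ) / U := div_pos hd₀0 hU0
      -- the sub-system `g = (fᵢ)_{i ≠ i₀}`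
      have hg : IsBatemanHornSystem (fun j => f (i₀.succAbove j)) :=
        isBatemanHornSystem_succAbove hf i₀
      have hCg : 0 < batemanHornConst (fun j => f (i₀.succAbove j)) :=
        (IsBatemanHornSystem.hasBatemanHornConst_holds hg).2
      have hIH := IH (fun j => f (i₀.succAbove j)) hg U (fun j => hU (i₀.succAbove j))
      -- Mertens for the ratio `A_f/A_g`, transported to the threshold `⌈x^{d₀/U}⌉₊ - 1`
      have hψ : Tendsto (fun n : ℕ => Real.log n ^ 1 *
          ((∏ p ∈ Nat.primesLE n, (1 - (polyRootCountMod f p : ℝ) / p)) /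
            ∏ p ∈ Nat.primesLE n,
              (1 - (polyRootCountMod (fun j => f (i₀.succAbove j)) p : ℝ) / p))) atTop
          (𝓝 (batemanHornConst f *
              Real.exp (-(((k + 1 : ℕ) : ℝ) * Real.eulerMascheroniConstant)) /
            (batemanHornConst (fun j => f (i₀.succAbove j)) *
              Real.exp (-((k : ℝ) * Real.eulerMascheroniConstant))))) := by
        simpa only [pow_one] using tendsto_log_mul_prod_div_prod hf i₀
      have hcomp := BatemanHornMertens.tendsto_log_pow_mul_comp 1 hc0 hψ
        (BatemanHornMertens.tendsto_ceil_rpow_sub_one_atTop hc0)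
        (BatemanHornMertens.tendsto_log_ceil_rpow_sub_one_div_log hc0)
      simp only [pow_one] at hcomp
      have hprod := hIH.mul hcomp
      -- the value of the limit
      have hDf : ∏ i, ((f i).natDegree : ℝ) =
          ((f i₀).natDegree : ℝ) * ∏ j, ((f (i₀.succAbove j)).natDegree : ℝ) :=
        Fin.prod_univ_succAbove (fun i => ((f i).natDegree : ℝ)) i₀
      have hDg : (0 : ℝ) < ∏ j, ((f (i₀.succAbove j)).natDegree : ℝ) :=
        prod_pos fun j _ => by exact_mod_cast hg.natDegree_pos j
      have hexp : Real.exp (-((k : ℝ) * Real.eulerMascheroniConstant)) ≠ 0 := (Real.exp_pos _).ne'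
      have hCg0 : batemanHornConst (fun j => f (i₀.succAbove j)) ≠ 0 := hCg.ne'
      have hU0' : U ≠ 0 := hU0.ne'
      have hd0' : ((f i₀).natDegree : ℝ) ≠ 0 := hd₀0.ne'
      have hDg0 : (∏ j, ((f (i₀.succAbove j)).natDegree : ℝ)) ≠ 0 := hDg.ne'
      have hlim : batemanHornConst (fun j => f (i₀.succAbove j)) /
              (∏ j, ((f (i₀.succAbove j)).natDegree : ℝ)) *
            Real.exp (-((k : ℝ) * Real.eulerMascheroniConstant)) * U ^ k *
          (batemanHornConst f * Real.exp (-(((k + 1 : ℕ) : ℝ) * Real.eulerMascheroniConstant)) /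
            (batemanHornConst (fun j => f (i₀.succAbove j)) *
              Real.exp (-((k : ℝ) * Real.eulerMascheroniConstant))) *
            (((f i₀).natDegree : ℝ) / U)⁻¹) =
          batemanHornConst f / (∏ i, ((f i).natDegree : ℝ)) *
            Real.exp (-(((k + 1 : ℕ) : ℝ) * Real.eulerMascheroniConstant)) * U ^ (k + 1) := by
        rw [hDf]
        field_simp
        ring
      rw [hlim] at hprod
      refine hprod.congr' ?_
      -- the eventual identity `(log x)^{k+1} V_f = ((log x)^k V_g) · (log x · A_f/A_g)`
      filter_upwards [eventually_ge_atTop 1] with x hx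
      have hAg : (∏ p ∈ Nat.primesLE (⌈(x : ℝ) ^ (((f i₀).natDegree : ℝ) / U)⌉₊ - 1),
          (1 - (polyRootCountMod (fun j => f (i₀.succAbove j)) p : ℝ) / p)) ≠ 0 :=
        (prod_one_sub_div_pos hg _).ne'
      have hid := staggeredProd_mul_eq f i₀ hmin (hU i₀) hx
      simp only [pow_succ]
      rw [mul_div_assoc', mul_div_assoc', div_eq_iff hAg]
      linear_combination (Real.log x) ^ k * Real.log x * hid.symm

end SieveCalibration

end Summit.Parity.BatemanHorn.Theorems

end
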